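import Mathlib
import Literature.Probability.Percolation.HarrisLocal
import Literature.Probability.Percolation.PercolationEvents
import Literature.Probability.LatticeModels.LatticeGraph
import Literature.Probability.LatticeModels.ThermodynamicLimit
import HarnessLib

/-!
# Stub `stub_boxTransport` of crux `AxialLogConvex` (stmt-CriticalPhenomena-11549), line `registered`

Crux: `Summit.CriticalPhenomena.PercolationContinuityZ3.Theses.PercAxialLogConvexity.AxialLogConvex`
(log-convexity of the axial two-point function of bond percolation on `ℤ³`), line `registered`
(tree `Lines/birth`: transfer to the torus tubes `T_k = ℤ × (ℤ/kℤ)²` realised as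
`zdGraph 1 □ torusGraph 2 k` on `Site 1 × TorusSite 2 k`).

Statement proved here (shared infrastructure of the two approximation stubs): with
`ι_k : Site 3 → Site 1 × TorusSite 2 k`, `ι_k x = ((fun _ => x 0), Torus.proj k (Fin.tail x))`,
and the pull-back `Φ ω := (Sym2.map ι_k)⁻¹' ω` of a tube configuration to `ℤ³`, every event `A`
determined by the pairs `(box 3 m).sym2` of the box `B(m)` satisfies
`P_p^{T_k}({ω | Φ ω ∈ A}) = P_p^{ℤ³}(A)` as soon as `2m + 2 ≤ k`.

Argument (Grimmett 1999, §1.6 / §2.2, "locality"; finite combinatorics only):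
* geometry: for `2m+2 ≤ k`, `ι_k` is injective on `B(m)` and is a local graph isomorphism there
  (`x ∼ y` in `ℤ³` iff `ι_k x ∼ ι_k y` in `T_k`, for `x, y ∈ B(m)`); hence `Sym2.map ι_k` is
  injective on `(box 3 m).sym2` and preserves (non-)edges;
* transport: by `real_eq_sum_of_determinedBy` both probabilities are finite sums of cylinder
  weights over patterns `a : F → Bool`; reindexing along the bijection `F ≃ F.image (Sym2.map ι_k)`
  matches weights (the one-coordinate law `coordMeasure` only sees whether the coordinate is an
  edge) and indicators (the pull-back of the pattern configuration has the same trace on `F`).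

Tree lemmas used: `Literature.Probability.Percolation.real_eq_sum_of_determinedBy`, `cylWeight`,
`cfgOf`, `coordMeasure`, `determinedBy_iff`, `Literature.Probability.LatticeModels.zdGraph_adj_iff`,
`torusGraph_adj_iff`, `Torus.proj_apply`, `mem_box`; Mathlib: `SimpleGraph.boxProd_adj`,
`Sym2.map_mk`, `Sym2.eq_iff`, `Finset.mk_mem_sym2_iff`, `Fintype.sum_equiv`, `Fintype.prod_equiv`,
`Equiv.ofBijective`, `ZMod.intCast_eq_intCast_iff_dvd_sub`, `Int.eq_zero_of_abs_lt_dvd`.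
-/

noncomputable section

namespace Summit.CriticalPhenomena.PercolationContinuityZ3.Theorems.AxialLogConvex

namespace StubBoxTransport

open Literature.Probability.Percolation Literature.Probability.LatticeModels

/-! #### Abstract transport of local events between two bond percolation models -/

/-- Membership in the pattern configuration `cfgOf F a` (definitional unfolding). [folklore] -/
theorem mem_cfgOf_iff {V : Type*} (F : Finset (Sym2 V)) (a : F → Bool) (e : Sym2 V) :
    e ∈ cfgOf F a ↔ ∃ h : e ∈ F, a ⟨e, h⟩ = true := Iff.rfl

/-- **Transport of local events.** Let `φ : F ≃ F'` be a bijection between finite sets of pairs of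
two graphs `G`, `G'` which preserves being an edge, and let `Φ` pull configurations of `G'` back to
configurations of `G` compatibly with `φ` on `F`. Then for every event `A` determined by `F`,
`P_p^{G'}(Φ⁻¹ A) = P_p^{G}(A)`: both sides are the same finite sum of cylinder weights
(`real_eq_sum_of_determinedBy`). (Grimmett 1999, §2.2.) [folklore] -/
theorem real_preimage_eq {V W : Type*} (G : SimpleGraph V) (G' : SimpleGraph W)
    (p : unitInterval) (F : Finset (Sym2 V)) (F' : Finset (Sym2 W)) (φ : F ≃ F')
    (hedge : ∀ e : F, (e : Sym2 V) ∈ G.edgeSet ↔ ((φ e : F') : Sym2 W) ∈ G'.edgeSet)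
    (Φ : BondConfig W → BondConfig V)
    (hΦ : ∀ (ω : BondConfig W) (e : F), (e : Sym2 V) ∈ Φ ω ↔ ((φ e : F') : Sym2 W) ∈ ω)
    {A : Set (BondConfig V)} (hA : DeterminedBy A (↑F : Set (Sym2 V))) :
    (bondPercolation G' p).real (Φ ⁻¹' A) = (bondPercolation G p).real A := by
  classical
  have hAiff := (determinedBy_iff A _).1 hA
  -- the pulled-back event is determined by `F'`
  have hA' : DeterminedBy (Φ ⁻¹' A) (↑F' : Set (Sym2 W)) := by
    rw [determinedBy_iff]
    intro ω ω' hωω'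
    rw [Set.mem_preimage, Set.mem_preimage]
    refine hAiff _ _ (Set.ext fun e => ?_)
    simp only [Set.mem_inter_iff, Finset.mem_coe]
    constructor
    · rintro ⟨he, heF⟩
      have h1 := (Set.ext_iff.1 hωω' ((φ ⟨e, heF⟩ : F') : Sym2 W)).1
        ⟨(hΦ ω ⟨e, heF⟩).1 he, (φ ⟨e, heF⟩).2⟩
      exact ⟨(hΦ ω' ⟨e, heF⟩).2 h1.1, heF⟩
    · rintro ⟨he, heF⟩
      have h1 := (Set.ext_iff.1 hωω' ((φ ⟨e, heF⟩ : F') : Sym2 W)).2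
        ⟨(hΦ ω' ⟨e, heF⟩).1 he, (φ ⟨e, heF⟩).2⟩
      exact ⟨(hΦ ω ⟨e, heF⟩).2 h1.1, heF⟩
  rw [real_eq_sum_of_determinedBy G p F hA, real_eq_sum_of_determinedBy G' p F' hA']
  refine Fintype.sum_equiv (φ.symm.arrowCongr (Equiv.refl Bool)) _ _ fun b => ?_
  have hb : (φ.symm.arrowCongr (Equiv.refl Bool)) b = b ∘ φ := by
    funext e
    simp [Equiv.arrowCongr_apply]
  rw [hb]
  -- weights agree termwise along `φ`
  have hw : cylWeight G' p F' b = cylWeight G p F (b ∘ φ) := by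
    unfold cylWeight
    refine (Fintype.prod_equiv φ _ _ fun e => ?_).symm
    have hP : ((e : Sym2 V) ∈ G.edgeSet) = (((φ e : F') : Sym2 W) ∈ G'.edgeSet) :=
      propext (hedge e)
    simp only [Function.comp_apply, coordMeasure, hP]
  -- indicators agree: the two pattern configurations have matching traces on `F`, `F'`
  have hiff : cfgOf F (b ∘ φ) ∈ A ↔ cfgOf F' b ∈ Φ ⁻¹' A := by
    rw [Set.mem_preimage]
    refine hAiff _ _ (Set.ext fun e => ?_)
    constructor
    · rintro ⟨he, heF⟩
      obtain ⟨heF', hbe⟩ := (mem_cfgOf_iff F _ e).1 he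
      refine ⟨(hΦ _ ⟨e, heF'⟩).2 ((mem_cfgOf_iff F' b _).2 ⟨(φ ⟨e, heF'⟩).2, ?_⟩), heF⟩
      simpa using hbe
    · rintro ⟨he, heF⟩
      obtain ⟨_, hbe⟩ := (mem_cfgOf_iff F' b _).1 ((hΦ _ ⟨e, heF⟩).1 he)
      exact ⟨(mem_cfgOf_iff F _ e).2 ⟨heF, by simpa using hbe⟩, heF⟩
  have hi : (Φ ⁻¹' A).indicator (1 : BondConfig W → ℝ) (cfgOf F' b) =
      A.indicator (1 : BondConfig V → ℝ) (cfgOf F (b ∘ φ)) := by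
    by_cases h : cfgOf F (b ∘ φ) ∈ A
    · rw [Set.indicator_of_mem h, Set.indicator_of_mem (hiff.1 h)]; rfl
    · rw [Set.indicator_of_notMem h, Set.indicator_of_notMem (fun h' => h (hiff.2 h'))]
  rw [hw, hi]

/-! #### Geometry of the tube map `ι_k` on a box -/

/-- Integers at distance `< k` with equal residues mod `k` are equal. [folklore] -/
theorem int_eq_of_zmod_eq {k : ℕ} {a b : ℤ} (h : |b - a| < k)
    (hab : (a : ZMod k) = (b : ZMod k)) : a = b := by
  rw [ZMod.intCast_eq_intCast_iff_dvd_sub] at hab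
  have := Int.eq_zero_of_abs_lt_dvd hab h
  omega

variable {k : ℕ}

/-- Near-injectivity of `ι_k`: two sites with the same image whose coordinates differ by less
than `k` coincide. [folklore] -/
theorem eq_of_iota_eq (ι : Site 3 → Site 1 × TorusSite 2 k)
    (hι : ι = fun x => ((fun _ : Fin 1 => x 0), Torus.proj k (Fin.tail x)))
    {x y : Site 3} (hxy : ι x = ι y) (hb : ∀ i, |y i - x i| < k) : x = y := by
  have h0 : x 0 = y 0 := by
    have := congrArg (fun q => q.1 0) hxy
    simpa [hι] using this
  have h1 : ∀ j : Fin 2, (x j.succ : ZMod k) = (y j.succ : ZMod k) := fun j => by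
    have := congrArg (fun q => q.2 j) hxy
    simpa [hι, Fin.tail] using this
  funext i
  rcases Fin.eq_zero_or_eq_succ i with rfl | ⟨j, rfl⟩
  · exact h0
  · exact int_eq_of_zmod_eq (hb j.succ) (h1 j)

/-- `ι_k` is injective on the box `B(m)` once `2m + 2 ≤ k`. [folklore] -/
theorem injOn_iota (ι : Site 3 → Site 1 × TorusSite 2 k)
    (hι : ι = fun x => ((fun _ : Fin 1 => x 0), Torus.proj k (Fin.tail x)))
    {m : ℕ} (hk : 2 * m + 2 ≤ k) : Set.InjOn ι ↑(box 3 m) := by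
  intro x hx y hy hxy
  rw [Finset.mem_coe, mem_box] at hx hy
  refine eq_of_iota_eq ι hι hxy fun i => ?_
  obtain ⟨hx1, hx2⟩ := hx i
  obtain ⟨hy1, hy2⟩ := hy i
  rw [abs_lt]; constructor <;> omega

/-- `ι_k` of a unit step in the `ℤ`-direction. [folklore] -/
theorem iota_add_single_zero (ι : Site 3 → Site 1 × TorusSite 2 k)
    (hι : ι = fun x => ((fun _ : Fin 1 => x 0), Torus.proj k (Fin.tail x))) (x : Site 3) :
    ι (x + Pi.single 0 1) = ((ι x).1 + Pi.single 0 1, (ι x).2) := by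
  subst hι
  refine Prod.ext ?_ ?_
  · funext j
    have hj : j = 0 := Fin.fin_one_eq_zero j
    subst hj
    simp
  · funext j
    simp [Fin.tail]

/-- `ι_k` of a unit step in a torus direction. [folklore] -/
theorem iota_add_single_succ (ι : Site 3 → Site 1 × TorusSite 2 k)
    (hι : ι = fun x => ((fun _ : Fin 1 => x 0), Torus.proj k (Fin.tail x))) (x : Site 3)
    (i : Fin 2) : ι (x + Pi.single i.succ 1) = ((ι x).1, (ι x).2 + Pi.single i 1) := by
  subst hι
  refine Prod.ext ?_ ?_
  · funext j
    simp only [Pi.add_apply, Pi.single_apply]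
    rw [if_neg (Fin.succ_ne_zero i).symm, add_zero]
  · funext j
    by_cases hj : j = i
    · subst hj
      simp [Fin.tail]
    · simp [Fin.tail, hj]

/-- Unit steps of `ℤ³` map to edges of the tube `T_k` (`k ≠ 1`). [folklore] -/
theorem adj_iota_add_single (ι : Site 3 → Site 1 × TorusSite 2 k)
    (hι : ι = fun x => ((fun _ : Fin 1 => x 0), Torus.proj k (Fin.tail x))) (hk : 1 < k)
    (x : Site 3) (i : Fin 3) :
    ((zdGraph 1).boxProd (torusGraph 2 k)).Adj (ι x) (ι (x + Pi.single i 1)) := by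
  rw [SimpleGraph.boxProd_adj]
  rcases Fin.eq_zero_or_eq_succ i with rfl | ⟨j, rfl⟩
  · left
    rw [iota_add_single_zero ι hι x]
    exact ⟨(zdGraph_adj_iff _ _).2 ⟨0, Or.inl rfl⟩, rfl⟩
  · right
    rw [iota_add_single_succ ι hι x j]
    refine ⟨(torusGraph_adj_iff _ _).2 ⟨?_, Or.inl ⟨j, rfl⟩⟩, rfl⟩
    intro h
    have h' := congrFun h j
    haveI : Fact (1 < k) := ⟨hk⟩
    simp at h'

/-- Edges of `ℤ³` map to edges of the tube `T_k` (`k ≠ 1`). [folklore] -/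
theorem adj_iota_of_adj (ι : Site 3 → Site 1 × TorusSite 2 k)
    (hι : ι = fun x => ((fun _ : Fin 1 => x 0), Torus.proj k (Fin.tail x))) (hk : 1 < k)
    {x y : Site 3} (h : (zdGraph 3).Adj x y) :
    ((zdGraph 1).boxProd (torusGraph 2 k)).Adj (ι x) (ι y) := by
  obtain ⟨i, h | h⟩ := (zdGraph_adj_iff x y).1 h
  · subst h
    exact adj_iota_add_single ι hι hk x i
  · subst h
    exact (adj_iota_add_single ι hι hk y i).symm

/-- Coordinates of two box sites, one shifted by a unit vector, differ by less than `k` when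
`2m + 2 ≤ k`. [folklore] -/
theorem abs_sub_add_single_lt {m : ℕ} (hk : 2 * m + 2 ≤ k) {x y : Site 3}
    (hx : x ∈ box 3 m) (hy : y ∈ box 3 m) (i l : Fin 3) :
    |y l - (x + Pi.single i 1 : Site 3) l| < (k : ℤ) := by
  rw [mem_box] at hx hy
  obtain ⟨hx1, hx2⟩ := hx l
  obtain ⟨hy1, hy2⟩ := hy l
  rw [Pi.add_apply, Pi.single_apply, abs_lt]
  split_ifs <;> constructor <;> omega

/-- Local isomorphism, converse direction: inside the box `B(m)` with `2m + 2 ≤ k`, sites whose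
images are adjacent in the tube `T_k` are adjacent in `ℤ³`. [folklore] -/
theorem adj_of_adj_iota (ι : Site 3 → Site 1 × TorusSite 2 k)
    (hι : ι = fun x => ((fun _ : Fin 1 => x 0), Torus.proj k (Fin.tail x)))
    {m : ℕ} (hk : 2 * m + 2 ≤ k) {x y : Site 3} (hx : x ∈ box 3 m) (hy : y ∈ box 3 m)
    (h : ((zdGraph 1).boxProd (torusGraph 2 k)).Adj (ι x) (ι y)) : (zdGraph 3).Adj x y := by
  rw [SimpleGraph.boxProd_adj] at h
  rw [zdGraph_adj_iff]
  rcases h with ⟨h1, h2⟩ | ⟨h1, h2⟩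
  · -- a step in the `ℤ`-direction
    obtain ⟨i, h1 | h1⟩ := (zdGraph_adj_iff _ _).1 h1
    · obtain rfl : i = 0 := Fin.fin_one_eq_zero i
      refine ⟨0, Or.inl (eq_of_iota_eq ι hι ?_ (abs_sub_add_single_lt hk hx hy 0)).symm⟩
      rw [iota_add_single_zero ι hι x]
      exact Prod.ext h1.symm h2
    · obtain rfl : i = 0 := Fin.fin_one_eq_zero i
      refine ⟨0, Or.inr (eq_of_iota_eq ι hι ?_ (abs_sub_add_single_lt hk hy hx 0)).symm⟩
      rw [iota_add_single_zero ι hι y]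
      exact Prod.ext h1.symm h2.symm
  · -- a step in a torus direction
    obtain ⟨-, ⟨i, h1⟩ | ⟨i, h1⟩⟩ := (torusGraph_adj_iff _ _).1 h1
    · refine ⟨i.succ, Or.inl (eq_of_iota_eq ι hι ?_ (abs_sub_add_single_lt hk hx hy _)).symm⟩
      rw [iota_add_single_succ ι hι x i]
      exact Prod.ext h2 h1.symm
    · refine ⟨i.succ, Or.inr (eq_of_iota_eq ι hι ?_ (abs_sub_add_single_lt hk hy hx _)).symm⟩
      rw [iota_add_single_succ ι hι y i]
      exact Prod.ext h2.symm h1.symm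

/-- `Sym2.map ι_k` is injective on the pairs of the box `B(m)` (`2m + 2 ≤ k`). [folklore] -/
theorem sym2Map_injOn (ι : Site 3 → Site 1 × TorusSite 2 k)
    (hι : ι = fun x => ((fun _ : Fin 1 => x 0), Torus.proj k (Fin.tail x)))
    {m : ℕ} (hk : 2 * m + 2 ≤ k) : Set.InjOn (Sym2.map ι) ↑((box 3 m).sym2) := by
  intro e he e' he'
  revert he he'
  refine Sym2.inductionOn₂ e e' fun a b c d => ?_
  intro hab hcd h
  rw [Finset.mem_coe, Finset.mk_mem_sym2_iff] at hab hcd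
  rw [Sym2.map_mk, Sym2.map_mk, Sym2.eq_iff] at h
  have hinj := injOn_iota ι hι hk
  rw [Sym2.eq_iff]
  rcases h with ⟨h1, h2⟩ | ⟨h1, h2⟩
  · exact Or.inl ⟨hinj hab.1 hcd.1 h1, hinj hab.2 hcd.2 h2⟩
  · exact Or.inr ⟨hinj hab.1 hcd.2 h1, hinj hab.2 hcd.1 h2⟩

/-- Local isomorphism on pairs: a pair of box sites is an edge of `ℤ³` iff its image is an edge
of the tube `T_k` (`2m + 2 ≤ k`). [folklore] -/
theorem mem_edgeSet_iff_map (ι : Site 3 → Site 1 × TorusSite 2 k)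
    (hι : ι = fun x => ((fun _ : Fin 1 => x 0), Torus.proj k (Fin.tail x)))
    {m : ℕ} (hk : 2 * m + 2 ≤ k) {e : Sym2 (Site 3)} (he : e ∈ (box 3 m).sym2) :
    e ∈ (zdGraph 3).edgeSet ↔ Sym2.map ι e ∈ ((zdGraph 1).boxProd (torusGraph 2 k)).edgeSet := by
  revert he
  refine Sym2.inductionOn e fun a b => ?_
  intro hab
  rw [Finset.mk_mem_sym2_iff] at hab
  rw [Sym2.map_mk, SimpleGraph.mem_edgeSet, SimpleGraph.mem_edgeSet]
  exact ⟨adj_iota_of_adj ι hι (by omega), adj_of_adj_iota ι hι hk hab.1 hab.2⟩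

/-- **The transport statement** for the concrete tube map (all of `stub_boxTransport` with `ι_k`
abstracted into a variable with its defining equation). [folklore] -/
theorem transport (ι : Site 3 → Site 1 × TorusSite 2 k)
    (hι : ι = fun x => ((fun _ : Fin 1 => x 0), Torus.proj k (Fin.tail x)))
    {m : ℕ} (hk : 2 * m + 2 ≤ k) (p : unitInterval) {A : Set (BondConfig (Site 3))}
    (hA : DeterminedBy A (↑((box 3 m).sym2) : Set (Sym2 (Site 3)))) :
    (bondPercolation ((zdGraph 1).boxProd (torusGraph 2 k)) p).real
        {ω : BondConfig (Site 1 × TorusSite 2 k) | (Sym2.map ι) ⁻¹' ω ∈ A} =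
      (bondPercolation (zdGraph 3) p).real A := by
  classical
  set F : Finset (Sym2 (Site 3)) := (box 3 m).sym2 with hF
  let F' : Finset (Sym2 (Site 1 × TorusSite 2 k)) := F.image (Sym2.map ι)
  have hinj : Set.InjOn (Sym2.map ι) ↑F := sym2Map_injOn ι hι hk
  let f : F → F' := fun e => ⟨Sym2.map ι e, Finset.mem_image_of_mem _ e.2⟩
  have hf : Function.Bijective f := by
    constructor
    · rintro ⟨e, he⟩ ⟨e', he'⟩ h
      have h' : Sym2.map ι e = Sym2.map ι e' := congrArg Subtype.val h
      exact Subtype.ext (hinj he he' h')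
    · rintro ⟨e', he'⟩
      obtain ⟨e, he, rfl⟩ := Finset.mem_image.mp he'
      exact ⟨⟨e, he⟩, rfl⟩
  exact real_preimage_eq (zdGraph 3) ((zdGraph 1).boxProd (torusGraph 2 k)) p F F'
    (Equiv.ofBijective f hf) (fun e => mem_edgeSet_iff_map ι hι hk e.2)
    (fun ω => (Sym2.map ι) ⁻¹' ω) (fun _ _ => Iff.rfl) hA

end StubBoxTransport

/-- **stub_boxTransport** (shared infrastructure of line `registered` for crux `AxialLogConvex`).
Product-measure transport between the torus tube `T_k = zdGraph 1 □ torusGraph 2 k` and `ℤ³` on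
local events: for `k ≥ 2m+2` the map `ι_k x = ((x 0), Torus.proj k (Fin.tail x))` restricted to
the box `B(m)` is injective and a graph isomorphism onto its image (pairs of `B(m)` are edges of
`ℤ³` iff their images are edges of `T_k`), so for every event `A` determined by the pairs of
`B(m)` the pulled-back event `{ω' | (Sym2.map ι_k)⁻¹' ω' ∈ A}` has the same
`P_p^{T_k}`-probability as `P_p^{ℤ³}(A)` (both are the same finite sum of cylinder weights,
`real_eq_sum_of_determinedBy`). (Grimmett 1999, §1.6, §2.2.) [folklore] -/
theorem stub_boxTransport :
    ∀ (m k : ℕ), 2 * m + 2 ≤ k → ∀ (p : unitInterval) (A : Set (Literature.Probability.Percolation.BondConfig (Literature.Probability.LatticeModels.Site 3))), Literature.Probability.Percolation.DeterminedBy A (↑((Literature.Probability.LatticeModels.box 3 m).sym2) : Set (Sym2 (Literature.Probability.LatticeModels.Site 3))) → (Literature.Probability.Percolation.bondPercolation ((Literature.Probability.LatticeModels.zdGraph 1).boxProd (Literature.Probability.LatticeModels.torusGraph 2 k)) p).real {ω : Literature.Probability.Percolation.BondConfig (Literature.Probability.LatticeModels.Site 1 × Literature.Probability.LatticeModels.TorusSite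 2 k) | (Sym2.map (fun x : Literature.Probability.LatticeModels.Site 3 => ((fun _ : Fin 1 => x 0), Literature.Probability.LatticeModels.Torus.proj k (Fin.tail x)))) ⁻¹' ω ∈ A} = (Literature.Probability.Percolation.bondPercolation (Literature.Probability.LatticeModels.zdGraph 3) p).real A := by
  intro m k hk p A hA
  exact StubBoxTransport.transport
    (fun x : Literature.Probability.LatticeModels.Site 3 =>
      ((fun _ : Fin 1 => x 0), Literature.Probability.LatticeModels.Torus.proj k (Fin.tail x)))
    rfl hk p hA

end Summit.CriticalPhenomena.PercolationContinuityZ3.Theorems.AxialLogConvex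

end
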